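import Summits.BirchSwinnertonDyer.BirchSwinnertonDyer.Theorems.PrintCf2DisegniPairTwoChiLineValuesTwo
import Summits.BirchSwinnertonDyer.Rank1Residual.Additive.DisegniLinePointwise
import HarnessLib

/-!
# Road (C) `disegni-pair-two` on crux stmt-BirchSwinnertonDyer-20368 — STEP B₂(1): Disegni's line
# function on the `χ₈ ∘ N`-line at `p = 2`, at EVERY typed point, equals `c ·` (MTT value of `f`) `·`
# (MTT value of `f′`) at the REFLECTED point `−T−2` (Artin formalism + continuation + STEP A₂)

Cell `bsd-print-cf2`, width seat `bsd-line-cf2-p1-w8` g21; third file of the `p = 2` factorisation chain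
(`…ChiLineValues` §1, `…ChiLineValuesTwo` §2–§3). THEOREMS ONLY (no `def`, no named fact, no `sorry`);
`--supports stmt-BirchSwinnertonDyer-20368`. BSD is not proved by any of this. This is the `p = 2` twin
of the addord seat's STEP B(1) (`hasLineValueAt_twin_of_cycLineInterpolation`): given Disegni's Theorem A
on the line through `χ = χ₈ ∘ N_{K/ℚ}` (`hG : Disegni2017.ChiLineInterpolation ι K f a χ 𝔭 𝔭′ Car G`,
`a = ι(α)`), the ARTIN FORMALISM for base change to the quadratic `K` — a tree THEOREM,
`rankinSelbergEulerProductHecke_baseChangeDirichlet_eq_holds`: `L(f_K ⊗ ξ∘N, s) = L(f⊗ξ, s)·L(f⊗ξκ_K, s)`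
— identifies the Rankin–Selberg Euler product at the point `θ` of the line (line character
`χ₈∘N · θ∘N = (θχ₈)∘N`, resp. `𝟙_K` at `θ = χ₈`) with the product of two Dirichlet-twisted `L`-series,
the second being `L(f′⊗ξ, s)` for the newform `f′` with `a_n(f′) = κ_K(n)a_n(f)` (the twist of `f` by the
Kronecker character of `K`); their entire continuations (`exists_differentiable_eq_twistedLSeries_holds`)
give a continuation of the Euler product, at which Theorem A may be evaluated, and STEP A₂ computes the
value:

* `hasLineValueAt_chi8Line_zero` — at `T = 0` (`θ = 𝟙`): `G(0) = c · v₈(f) · v₈(f′)`,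
  `v₈(g) = α⁻³ Σ_b χ₈(b)[b/8]⁺_g` = the MTT value of `L₂(g, α, T)` at `T = χ₈(5) − 1 = −2`;
* `hasLineValueAt_chi8Line_neg_two` — at `T = −2` (`θ = χ₈`): `G(−2) = c · (1−α⁻¹)²[0]⁺_f ·
  (1−α⁻¹)²[0]⁺_{f′}` = `c · L₂(f,α,0) · L₂(f′,α,0)`;
* `hasLineValueAt_chi8Line_of_three_le` — at `T = cycLinePoint ι θ`, `θ` primitive even mod
  `2^{m+1}`, `m ≥ 3`: `G(T) = c · v_ξ(f) · v_ξ(f′)`, `v_ξ(g)` the MTT value of `L₂(g,α,·)` at the twin of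
  `ξ = θχ₈`, whose point is `−T−2` (`cycLinePoint_mul_chi8`).

In all three cases the MTT side is read at the REFLECTION `T ↦ −T−2` of the `G`-side point: this is the
content of the factorisation `G(T) = c · L₂(f,α)(−T−2) · L₂(f′,α)(−T−2)` proved in the next file by
re-centring and the uniqueness principle.

References: [Disegni2017] Thm. A (arXiv v3 PDF pp. 6–7); [Gross2004] §3 (p. 40), §13 (p. 49) (Artin
formalism); [MazurTateTeitelbaum1986Invent] §I.8 (8.6), §I.13, §I.14 (14.3); cell PREGRADE
`bsd-print-cf2-plan/PREGRADE-disegni-pair-two-skeleton-g24.md` §5.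
-/

set_option autoImplicit false
set_option linter.dupNamespace false

noncomputable section

open scoped Classical MatrixGroups ModularForm NumberField

open CongruenceSubgroup NumberField IsDedekindDomain Literature.NumberTheory.EllipticCurves
  Literature.NumberTheory.EllipticCurves.ModularForms
  Literature.NumberTheory.EllipticCurves.Disegni2017 Literature.NumberTheory.GaloisRepresentations
  Summit.BirchSwinnertonDyer.Rank1Residual.Additive

namespace Summit.BirchSwinnertonDyer.BirchSwinnertonDyer.Theorems.PrintCf2.DisegniPairTwo

section Pointwise

variable (ι : PadicAlgCl 2 ≃+* ℂ) (K : Type) [Field K] [NumberField K] [IsGalois ℚ K]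

/-! ### §1 The twisted Dirichlet series of `f` by `ξκ` is that of `f′ = f ⊗ κ` by `ξ` -/

/-- **`L(f ⊗ ξκ, s) = L(f′ ⊗ ξ, s)` termwise** when `a_n(f′) = κ(n)·a_n(f)` for all `n` (`κ` the
Kronecker character of `K`, `f′` the newform of the twist). [cite: Gross2004, §13 (p. 49)] -/
theorem twistedLSeries_mul_eq_of_coeff_kronecker' {N N' b : ℕ} [NeZero b] {f : CuspForm (Gamma0 N) 2}
    {f' : CuspForm (Gamma0 N') 2} (κ : DirichletCharacter ℂ b)
    (hV' : ∀ n : ℕ, cuspCoeff f' n = κ (n : ZMod b) * cuspCoeff f n)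
    {m : ℕ} [NeZero m] (ξ : DirichletCharacter ℂ m) (s : ℂ) :
    twistedLSeries f (DirichletCharacter.mul ξ κ) s = twistedLSeries f' ξ s := by
  unfold twistedLSeries
  congr 1
  funext n
  rw [hV' n, dirichletCharacter_mul_natCast]
  ring

/-! ### §2 The Rankin–Selberg Euler product on the line, continued (Artin formalism) -/

/-- **Artin formalism on the `χ₈∘N`-line at a RAMIFIED point**: for `ξ` primitive mod `2^n` (any
`n`, `(2^n, d_K) = 1` from `(2, d_K) = 1`) and the newform `f′` with `a_n(f′) = κ_K(n)a_n(f)`, the product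
of the entire continuations `Λ₁`, `Λ₂` of `L(f⊗ξ, s)`, `L(f′⊗ξ, s)` continues
`rankinSelbergEulerProductHecke f (ξ∘N)` from `re s > 2`. [cite: Gross2004, §3 (p. 40), §13 (p. 49)]
[cite: NeukirchANT1999, Ch. VII (10.4) (iv)] -/
theorem rankinSelberg_baseChangeDirichlet_eq_mul (h2 : Module.finrank ℚ K = 2)
    (κ : DirichletCharacter ℂ (NumberField.discr K).natAbs)
    (hκ : ∀ ℓ : ℕ, ℓ.Prime → ℓ ≠ 2 → κ ℓ = (jacobiSym (NumberField.discr K) ℓ : ℂ))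
    (hκ2 : κ 2 = if NumberField.discr K % 8 = 1 then 1
        else if NumberField.discr K % 8 = 5 then -1 else 0)
    (hd : Nat.Coprime 2 (NumberField.discr K).natAbs)
    {N N' : ℕ} [NeZero N] [NeZero N'] {f : CuspForm (Gamma0 N) 2} {f' : CuspForm (Gamma0 N') 2}
    (hf : IsNewform0 f) (hV' : ∀ n : ℕ, cuspCoeff f' n = κ (n : ZMod _) * cuspCoeff f n)
    {n : ℕ} [NeZero (2 ^ n)] {ξ : DirichletCharacter ℂ (2 ^ n)} (hξ : ξ.IsPrimitive)
    {Λ₁ Λ₂ : ℂ → ℂ} (hΛ₁' : ∀ s : ℂ, 2 < s.re → Λ₁ s = twistedLSeries f ξ s)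
    (hΛ₂' : ∀ s : ℂ, 2 < s.re → Λ₂ s = twistedLSeries f' ξ s) :
    ∀ s : ℂ, 2 < s.re →
      (fun s ↦ Λ₁ s * Λ₂ s) s = rankinSelbergEulerProductHecke f (baseChangeDirichlet K ξ) s := by
  haveI : NeZero (NumberField.discr K).natAbs :=
    ⟨Int.natAbs_ne_zero.mpr (NumberField.discr_ne_zero K)⟩
  intro s hs
  simp only
  rw [hΛ₁' s hs, hΛ₂' s hs, ← twistedLSeries_mul_eq_of_coeff_kronecker' κ hV' ξ s,
    baseChangeDirichlet_def]
  exact (rankinSelbergEulerProductHecke_baseChangeDirichlet_eq_holds K h2 κ hκ hκ2 f hf ξ hξ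
    (Nat.Coprime.pow_left _ hd) s hs).symm

/-- **Artin formalism at the UNRAMIFIED point** (`θ = χ₈`, line character `𝟙_K`): the product of the
entire continuations of `L(f, s) = L(f⊗𝟙, s)` and `L(f′, s)` continues `rankinSelbergEulerProductHecke f 𝟙_K`
(`L(f_K, s) = L(f,s)L(f⊗κ_K,s)`, Gross 2004 §3). [cite: Gross2004, §3 (p. 40)] -/
theorem rankinSelberg_one_eq_mul (h2 : Module.finrank ℚ K = 2)
    (κ : DirichletCharacter ℂ (NumberField.discr K).natAbs)
    (hκ : ∀ ℓ : ℕ, ℓ.Prime → ℓ ≠ 2 → κ ℓ = (jacobiSym (NumberField.discr K) ℓ : ℂ))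
    (hκ2 : κ 2 = if NumberField.discr K % 8 = 1 then 1
        else if NumberField.discr K % 8 = 5 then -1 else 0)
    {N N' : ℕ} [NeZero N] [NeZero N'] {f : CuspForm (Gamma0 N) 2} {f' : CuspForm (Gamma0 N') 2}
    (hf : IsNewform0 f) (hV' : ∀ n : ℕ, cuspCoeff f' n = κ (n : ZMod _) * cuspCoeff f n)
    {Λ₁ Λ₂ : ℂ → ℂ}
    (hΛ₁' : ∀ s : ℂ, 2 < s.re → Λ₁ s = twistedLSeries f (1 : DirichletCharacter ℂ 1) s)
    (hΛ₂' : ∀ s : ℂ, 2 < s.re → Λ₂ s = twistedLSeries f' (1 : DirichletCharacter ℂ 1) s) :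
    ∀ s : ℂ, 2 < s.re →
      (fun s ↦ Λ₁ s * Λ₂ s) s = rankinSelbergEulerProductHecke f (1 : HeckeCharacter K) s := by
  haveI : NeZero (NumberField.discr K).natAbs :=
    ⟨Int.natAbs_ne_zero.mpr (NumberField.discr_ne_zero K)⟩
  haveI : NeZero (1 : ℕ) := ⟨one_ne_zero⟩
  intro s hs
  simp only
  rw [hΛ₁' s hs, hΛ₂' s hs,
    ← twistedLSeries_mul_eq_of_coeff_kronecker' κ hV' (1 : DirichletCharacter ℂ 1) s]
  exact (rankinSelbergEulerProductHecke_baseChangeDirichlet_eq.trivial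
    rankinSelbergEulerProductHecke_baseChangeDirichlet_eq_holds K h2 κ hκ hκ2 f hf hs).symm

/-! ### §3 Disegni's function at the typed points of the `χ₈∘N`-line -/

/-- ★ **STEP B₂(1) at `T = 0`** (the base point `θ = 𝟙` of the `χ₈∘N`-line; `K` quadratic with
`(2, d_K) = 1`, `2` split, `𝔭, 𝔭′ ∋ 2`; `f, f′` rational newforms with `a_n(f′) = κ_K(n)a_n(f)`; `α ∈ ℚ₂`,
`a = ι(α)`; `G` Disegni's line function, `ChiLineInterpolation`):
`G(0) = c · (α⁻³Σ_b χ_{χ₈}(b)[b/8]⁺_f) · (α⁻³Σ_b χ_{χ₈}(b)[b/8]⁺_{f′})`, `c = ι⁻¹(u·Car·Ω⁺_f·Ω⁺_{f′})` — the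
two factors being the MTT values of `L₂(f,α,T)`, `L₂(f′,α,T)` at `T = −2`.
[cite: Disegni2017, Theorem A (arXiv v3 PDF pp. 6–7)] [cite: Gross2004, §3, §13]
[cite: MazurTateTeitelbaum1986Invent, §I.14 (14.3)] -/
theorem hasLineValueAt_chi8Line_zero (h2 : Module.finrank ℚ K = 2)
    (hsplit : ((Ideal.span {(2 : ℤ)}).primesOver (𝓞 K)).ncard = 2)
    (𝔭 𝔭' : HeightOneSpectrum (𝓞 K)) (h𝔭 : ((2 : ℕ) : 𝓞 K) ∈ 𝔭.asIdeal)
    (h𝔭' : ((2 : ℕ) : 𝓞 K) ∈ 𝔭'.asIdeal)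
    (κ : DirichletCharacter ℂ (NumberField.discr K).natAbs)
    (hκ : ∀ ℓ : ℕ, ℓ.Prime → ℓ ≠ 2 → κ ℓ = (jacobiSym (NumberField.discr K) ℓ : ℂ))
    (hκ2 : κ 2 = if NumberField.discr K % 8 = 1 then 1
        else if NumberField.discr K % 8 = 5 then -1 else 0)
    (hd : Nat.Coprime 2 (NumberField.discr K).natAbs)
    {N N' : ℕ} [NeZero N] [NeZero N'] {f : CuspForm (Gamma0 N) 2} {f' : CuspForm (Gamma0 N') 2}
    (hf : IsNewform0 f) (hQ : coeffField f = ⊥) (hf' : IsNewform0 f') (hQ' : coeffField f' = ⊥)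
    (hV' : ∀ n : ℕ, cuspCoeff f' n = κ (n : ZMod _) * cuspCoeff f n)
    (α : ℚ_[2]) {Car : ℝ} {G : PowerSeries ℂ_[2]}
    (hG : ChiLineInterpolation ι K f (ι ((α : PadicAlgCl 2)))
      (baseChangeDirichlet K (ZMod.χ₈.ringHomComp (Int.castRingHom ℂ))) 𝔭 𝔭' Car G) :
    HasLineValueAt G 0
      (((ι.symm ((splitLocalConstant 2 : ℂ) * (Car : ℂ) * (plusPeriod f : ℂ) * (plusPeriod f' : ℂ)) :
          PadicAlgCl 2) : ℂ_[2]) *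
        (algebraMap ℚ_[2] ℂ_[2] (α⁻¹ ^ 3) *
          ratTwistedSymbolSum f
            (((ZMod.χ₈.ringHomComp (Int.castRingHom ℂ) : DirichletCharacter ℂ (2 ^ 3))⁻¹.ringHomComp
              ι.symm.toRingHom).ringHomComp (algebraMap (PadicAlgCl 2) ℂ_[2]))) *
        (algebraMap ℚ_[2] ℂ_[2] (α⁻¹ ^ 3) *
          ratTwistedSymbolSum f'
            (((ZMod.χ₈.ringHomComp (Int.castRingHom ℂ) : DirichletCharacter ℂ (2 ^ 3))⁻¹.ringHomComp
              ι.symm.toRingHom).ringHomComp (algebraMap (PadicAlgCl 2) ℂ_[2])))) := by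
  haveI : NeZero (2 ^ 3) := ⟨by norm_num⟩
  set χ₈₃ : DirichletCharacter ℂ (2 ^ 3) := ZMod.χ₈.ringHomComp (Int.castRingHom ℂ) with hχ₈₃
  -- continuations of the two twisted series and the Artin identity on the line at `θ = 𝟙`
  obtain ⟨Λ₁, hΛ₁, hΛ₁'⟩ := exists_differentiable_eq_twistedLSeries_holds (f := f) χ₈₃
  obtain ⟨Λ₂, hΛ₂, hΛ₂'⟩ := exists_differentiable_eq_twistedLSeries_holds (f := f') χ₈₃
  have hΛ : Differentiable ℂ (fun s ↦ Λ₁ s * Λ₂ s) := hΛ₁.mul hΛ₂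
  have hRS : ∀ s : ℂ, 2 < s.re → (fun s ↦ Λ₁ s * Λ₂ s) s =
      rankinSelbergEulerProductHecke f
        (baseChangeDirichlet K (ZMod.χ₈.ringHomComp (Int.castRingHom ℂ)) *
          baseChangeDirichlet K (1 : DirichletCharacter ℂ (2 ^ (0 + 1)))) s := by
    intro s hs
    rw [baseChangeDirichlet_one, mul_one]
    exact rankinSelberg_baseChangeDirichlet_eq_mul K h2 κ hκ hκ2 hd hf hV'
      (isPrimitive_χ₈_ringHomComp_of_charZero ℂ) hΛ₁' hΛ₂' s hs
  -- Theorem A at `θ = 𝟙`, then STEP A₂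
  have hval := hG.hasLineValueAt (θ := (1 : DirichletCharacter ℂ (2 ^ (0 + 1))))
    (MulChar.one_apply isUnit_one.neg) ⟨0, by rw [orderOf_one, pow_zero]⟩ (Or.inr rfl) hΛ hRS
  rw [cycLinePoint_one] at hval
  rwa [chiLineValue_chi8_level_two ι K h2 hsplit 𝔭 𝔭' h𝔭 h𝔭' hf hQ hf' hQ' α Car 1 hΛ₁ hΛ₁' hΛ₂
    hΛ₂'] at hval

/-- The point of `χ₈` (level `2³`) on the line is `T = χ₈(5)⁻¹ − 1 = −2`.
[cite: MazurTateTeitelbaum1986Invent, §I.13] -/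
theorem cycLinePoint_chi8 :
    cycLinePoint ι (m := 2) (ZMod.χ₈.ringHomComp (Int.castRingHom ℂ)) = -2 := by
  rw [cycLinePoint, cyclotomicGenerator_two, MulChar.ringHomComp_apply]
  have h : ZMod.χ₈ ((5 : ℕ) : ZMod (2 ^ (2 + 1))) = -1 := by decide
  rw [h, map_neg, map_one, map_neg, map_one, PadicComplex.coe_eq, map_neg, map_one, inv_neg, inv_one]
  norm_num

/-- ★ **STEP B₂(1) at `T = −2`** (the point `θ = χ₈`, where the line character is `𝟙_K`; `2 ∤ N`,
`α` a `2`-adic unit): `G(−2) = c · (1−α⁻¹)²[0]⁺_f · (1−α⁻¹)²[0]⁺_{f′}` — the two factors being the MTT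
constant terms `L₂(f,α,0)`, `L₂(f′,α,0)`. [cite: Disegni2017, Theorem A (arXiv v3 PDF pp. 6–7)]
[cite: Gross2004, §3] [cite: MazurTateTeitelbaum1986Invent, §I.14 (14.3)] -/
theorem hasLineValueAt_chi8Line_neg_two (h2 : Module.finrank ℚ K = 2)
    (𝔭 𝔭' : HeightOneSpectrum (𝓞 K))
    (κ : DirichletCharacter ℂ (NumberField.discr K).natAbs)
    (hκ : ∀ ℓ : ℕ, ℓ.Prime → ℓ ≠ 2 → κ ℓ = (jacobiSym (NumberField.discr K) ℓ : ℂ))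
    (hκ2 : κ 2 = if NumberField.discr K % 8 = 1 then 1
        else if NumberField.discr K % 8 = 5 then -1 else 0)
    {N N' : ℕ} [NeZero N] [NeZero N'] (hN : ¬ 2 ∣ N) {f : CuspForm (Gamma0 N) 2}
    {f' : CuspForm (Gamma0 N') 2}
    (hf : IsNewform0 f) (hQ : coeffField f = ⊥) (hf' : IsNewform0 f') (hQ' : coeffField f' = ⊥)
    (hV' : ∀ n : ℕ, cuspCoeff f' n = κ (n : ZMod _) * cuspCoeff f n)
    {α : ℚ_[2]} (hα : ‖α‖ = 1) {Car : ℝ} {G : PowerSeries ℂ_[2]}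
    (hG : ChiLineInterpolation ι K f (ι ((α : PadicAlgCl 2)))
      (baseChangeDirichlet K (ZMod.χ₈.ringHomComp (Int.castRingHom ℂ))) 𝔭 𝔭' Car G) :
    HasLineValueAt G (-2)
      (((ι.symm ((splitLocalConstant 2 : ℂ) * (Car : ℂ) * (plusPeriod f : ℂ) * (plusPeriod f' : ℂ)) :
          PadicAlgCl 2) : ℂ_[2]) *
        algebraMap ℚ_[2] ℂ_[2] ((1 - α⁻¹) ^ 2 * (ratPlusSymbol f 0 : ℚ_[2])) *
        algebraMap ℚ_[2] ℂ_[2] ((1 - α⁻¹) ^ 2 * (ratPlusSymbol f' 0 : ℚ_[2]))) := by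
  haveI : NeZero (1 : ℕ) := ⟨one_ne_zero⟩
  set θ : DirichletCharacter ℂ (2 ^ (2 + 1)) := ZMod.χ₈.ringHomComp (Int.castRingHom ℂ) with hθ
  obtain ⟨Λ₁, hΛ₁, hΛ₁'⟩ :=
    exists_differentiable_eq_twistedLSeries_holds (f := f) (1 : DirichletCharacter ℂ 1)
  obtain ⟨Λ₂, hΛ₂, hΛ₂'⟩ :=
    exists_differentiable_eq_twistedLSeries_holds (f := f') (1 : DirichletCharacter ℂ 1)
  have hΛ : Differentiable ℂ (fun s ↦ Λ₁ s * Λ₂ s) := hΛ₁.mul hΛ₂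
  have hRS : ∀ s : ℂ, 2 < s.re → (fun s ↦ Λ₁ s * Λ₂ s) s =
      rankinSelbergEulerProductHecke f
        (baseChangeDirichlet K (ZMod.χ₈.ringHomComp (Int.castRingHom ℂ)) * baseChangeDirichlet K θ) s := by
    intro s hs
    rw [hθ, baseChangeDirichlet_chi8_mul_self K]
    exact rankinSelberg_one_eq_mul K h2 κ hκ hκ2 hf hV' hΛ₁' hΛ₂' s hs
  have heven : θ.Even := chi8_even
  have hprim : θ.IsPrimitive := isPrimitive_χ₈_ringHomComp_of_charZero ℂ
  have hval := hG.hasLineValueAt (θ := θ) heven (exists_orderOf_eq_two_pow θ) (Or.inl hprim) hΛ hRS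
  rw [hθ, cycLinePoint_chi8] at hval
  rwa [chiLineValue_chi8_self ι K 𝔭 𝔭' hN hf hQ hf' hQ' hα Car heven hprim hΛ₁ hΛ₁' hΛ₂ hΛ₂'] at hval

/-- ★ **STEP B₂(1) at the points of level `2^{m+1} ≥ 16`** (`θ` primitive and even mod `2^{m+1}`,
`m ≥ 3`, `ξ = θχ₈`): `G(cycLinePoint ι θ) = c · (α^{−(m+1)}Σ_b χ_ξ(b)[b/2^{m+1}]⁺_f) ·
(α^{−(m+1)}Σ_b χ_ξ(b)[b/2^{m+1}]⁺_{f′})` — the two factors being the MTT values of `L₂(f,α,T)`, `L₂(f′,α,T)`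
at the twin of `ξ`, whose point is `−(cycLinePoint ι θ) − 2`.
[cite: Disegni2017, Theorem A (arXiv v3 PDF pp. 6–7)] [cite: Gross2004, §3, §13]
[cite: MazurTateTeitelbaum1986Invent, §I.8 (8.6), §I.14 (14.3)] -/
theorem hasLineValueAt_chi8Line_of_three_le (h2 : Module.finrank ℚ K = 2)
    (hsplit : ((Ideal.span {(2 : ℤ)}).primesOver (𝓞 K)).ncard = 2)
    (𝔭 𝔭' : HeightOneSpectrum (𝓞 K)) (h𝔭 : ((2 : ℕ) : 𝓞 K) ∈ 𝔭.asIdeal)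
    (h𝔭' : ((2 : ℕ) : 𝓞 K) ∈ 𝔭'.asIdeal)
    (κ : DirichletCharacter ℂ (NumberField.discr K).natAbs)
    (hκ : ∀ ℓ : ℕ, ℓ.Prime → ℓ ≠ 2 → κ ℓ = (jacobiSym (NumberField.discr K) ℓ : ℂ))
    (hκ2 : κ 2 = if NumberField.discr K % 8 = 1 then 1
        else if NumberField.discr K % 8 = 5 then -1 else 0)
    (hd : Nat.Coprime 2 (NumberField.discr K).natAbs)
    {N N' : ℕ} [NeZero N] [NeZero N'] {f : CuspForm (Gamma0 N) 2} {f' : CuspForm (Gamma0 N') 2}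
    (hf : IsNewform0 f) (hQ : coeffField f = ⊥) (hf' : IsNewform0 f') (hQ' : coeffField f' = ⊥)
    (hV' : ∀ n : ℕ, cuspCoeff f' n = κ (n : ZMod _) * cuspCoeff f n)
    (α : ℚ_[2]) {Car : ℝ} {G : PowerSeries ℂ_[2]}
    (hG : ChiLineInterpolation ι K f (ι ((α : PadicAlgCl 2)))
      (baseChangeDirichlet K (ZMod.χ₈.ringHomComp (Int.castRingHom ℂ))) 𝔭 𝔭' Car G)
    {m : ℕ} (hm : 3 ≤ m) (h8 : 8 ∣ 2 ^ (m + 1)) {θ : DirichletCharacter ℂ (2 ^ (m + 1))}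
    (heven : θ.Even) (hprim : θ.IsPrimitive) :
    HasLineValueAt G (cycLinePoint ι θ)
      (((ι.symm ((splitLocalConstant 2 : ℂ) * (Car : ℂ) * (plusPeriod f : ℂ) * (plusPeriod f' : ℂ)) :
          PadicAlgCl 2) : ℂ_[2]) *
        (algebraMap ℚ_[2] ℂ_[2] (α⁻¹ ^ (m + 1)) *
          ratTwistedSymbolSum f
            (((θ * DirichletCharacter.changeLevel h8 (ZMod.χ₈.ringHomComp (Int.castRingHom ℂ)))⁻¹.ringHomComp
              ι.symm.toRingHom).ringHomComp (algebraMap (PadicAlgCl 2) ℂ_[2]))) *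
        (algebraMap ℚ_[2] ℂ_[2] (α⁻¹ ^ (m + 1)) *
          ratTwistedSymbolSum f'
            (((θ * DirichletCharacter.changeLevel h8 (ZMod.χ₈.ringHomComp (Int.castRingHom ℂ)))⁻¹.ringHomComp
              ι.symm.toRingHom).ringHomComp (algebraMap (PadicAlgCl 2) ℂ_[2])))) := by
  set ξ := θ * DirichletCharacter.changeLevel h8 (ZMod.χ₈.ringHomComp (Int.castRingHom ℂ)) with hξ
  have hξprim : ξ.IsPrimitive := isPrimitive_mul_chi8_changeLevel hm h8 hprim
  obtain ⟨Λ₁, hΛ₁, hΛ₁'⟩ := exists_differentiable_eq_twistedLSeries_holds (f := f) ξ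
  obtain ⟨Λ₂, hΛ₂, hΛ₂'⟩ := exists_differentiable_eq_twistedLSeries_holds (f := f') ξ
  have hΛ : Differentiable ℂ (fun s ↦ Λ₁ s * Λ₂ s) := hΛ₁.mul hΛ₂
  have hRS : ∀ s : ℂ, 2 < s.re → (fun s ↦ Λ₁ s * Λ₂ s) s =
      rankinSelbergEulerProductHecke f
        (baseChangeDirichlet K (ZMod.χ₈.ringHomComp (Int.castRingHom ℂ)) * baseChangeDirichlet K θ) s := by
    intro s hs
    rw [baseChangeDirichlet_chi8_mul K h8 θ]
    exact rankinSelberg_baseChangeDirichlet_eq_mul K h2 κ hκ hκ2 hd hf hV' hξprim hΛ₁' hΛ₂' s hs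
  have hval := hG.hasLineValueAt (θ := θ) heven (exists_orderOf_eq_two_pow θ) (Or.inl hprim) hΛ hRS
  rwa [chiLineValue_chi8_of_three_le ι K h2 hsplit 𝔭 𝔭' h𝔭 h𝔭' hf hQ hf' hQ' α Car hm h8 heven hprim
    hΛ₁ hΛ₁' hΛ₂ hΛ₂'] at hval

end Pointwise

end Summit.BirchSwinnertonDyer.BirchSwinnertonDyer.Theorems.PrintCf2.DisegniPairTwo

end
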